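import Summits.BirchSwinnertonDyer.Rank1Residual.Additive.KummerLeGreenbergTwistLevel
import Summits.BirchSwinnertonDyer.Rank1Residual.GaloisImage.GreenbergKerCoprimeAscent
import HarnessLib

/-!
# The 'Kummer ⊆ Greenberg' inclusion over `ℚ_∞` for the TWISTED datum of `E = C • V^{(c)}` at an
# additive potentially-good-ordinary `p`, and the R-D IDENTIFICATION 'Kummer = Greenberg = strict'
# over `ℚ_∞` (mod the typed Greenberg Prop. 2.4) — row T-RD-Δ-K file F7, the (G-ord) '≥' COMPANION
# (cell `b2b-bsdres`, team n1011; lead R5-47 (a); cc-typer-2's bridge lemma (B1); seat n1011-p05 gen 4)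

HONEST FRAMING (cell `b2b-bsdres`, run/shared/lean/b2b/bsd-rank1-residual/, verbatim in every
file): the goal of the cell is to DELETE the COMBINATION-SHAPED residual classes of the
Birch–Swinnerton-Dyer formula for ALL analytic-rank `≤ 1` elliptic curves over `ℚ` — "full BSD
formula for every rank `≤ 1` curve in class `C`" assembled STRICTLY from published theorems — so
that the rank-`≤ 1` remainder becomes exactly the CONSTRUCTION-SHAPED classes, which are TYPED
(missing-input `Prop`s), NOT attempted. This is not "finishing BSD". Team n1011 (X4 ∧ `p = 3`,
§I N10/N11; ROUTE-2 of planner r2, §II.15.3 ARM δ): research route; TOOL theorems of Galois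
cohomology; the '≥' inclusion of this file is UNCONDITIONAL (no named fact enters); the EQUALITY
corollaries are CONDITIONAL on the typed published fact
`Greenberg1999.imKummer_ge_strictCondition_goodOrdinary` (cc-typer-2, p262636; record A239) taken
as the hypothesis `hGrK` exactly as in F5/F6; no definition, no named fact by this seat; nothing
booked; no label changes.

## What

Objects as in F7a `KummerLeGreenbergTwistLevel`: `V/ℚ` globally minimal, good at `p ∈ v`
(`p ∤ Δ_V`; ordinary, `p ∤ a_p(V)`, only where stated), `N_V = reductionDatum V p`, a
`ℤ_p`-extension `κ` (`ker κ = Gal(ℚ̄/ℚ_∞)`), `K = ℚ(θ)` quadratic (`θ² = c`, `θ ∉ ℚ`),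
`U = galRange K` (open normal, index `2`), a transport `t : V[p^∞] ≃+ W[p^∞]` with a sign rule,
equivariant on `U`, and `N_W = twistMap N_V t`.

* §3 `localKerOver_le_greenbergKer_twistMap_kerSubgroup` (generic `t`) — level `ker κ`:
  `W.localKerOver p (ker κ) ℚ_v ≤ N_W.greenbergKer (ker κ)`: F7a at level `ker κ ⊓ U`, then p07's
  prime-to-`p` ASCENT `GreenbergKerCoprimeAscent.localKerOver_le_greenbergKer_kerSubgroup_of_index_coprime`
  (restriction `H¹(I_v ∩ ker κ, N_W.Gr) → H¹(I_v ∩ ker κ ∩ U, N_W.Gr)` is injective: index `∣ 2`,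
  `p` odd). UNCONDITIONAL.
* §4 the geometric transport `t = twistPrimaryEquiv⁻¹ ≫ primaryIso` (additive-p1; F6):
  **`localKerOver_le_greenbergKer_twistMap_geomTransport`** — the END THEOREM '≥' (= cc-typer-2's
  (B1)), hypotheses ONLY `p ≠ 2`, `p ∤ Δ_V`, `p ∈ v`, `[K:ℚ] = 2`, `θ ∉ ℚ`, `θ² = c`,
  `C • V^{(c)} = W`; **`greenbergKer_twistMap_geomTransport_eq_localKerOver`** — the EQUALITY
  `N_W.greenbergKer (ker κ) = W.localKerOver p (ker κ) ℚ_v` (F6 '≤' mod `hGrK` ∧ '≥'), literally the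
  body of cc-typer-2's `Additive.RamifiedLineKummerEqAt W p` for the ONE datum `N_W` (her ∀-`L`
  binder needs in addition the uniqueness of the ramified ordinary line (B2) — file F8 displays it);
  `strictKer_twistMap_geomTransport_eq_localKerOver` — the same in Greenberg's STRICT currency
  (F7a `greenbergKer_twistMap_kerSubgroup_eq_strictKer`).

References: [GreenbergLNM1716] §2 pp. 69–75 (Props. 2.2/2.4), §5 p. 143; [GreenbergVatsal2000]
§2 p. 26; [SilvermanAEC2009] X.5 Cor. 5.4.
-/

noncomputable section

open scoped Classical

namespace Summit.BirchSwinnertonDyer.Rank1Residual.Additive.TameDescent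

open NumberField IsDedekindDomain Field Literature.NumberTheory.GaloisRepresentations
  Literature.NumberTheory.EllipticCurves Literature.NumberTheory.EllipticCurves.GreenbergSelmer
  Literature.NumberTheory.EllipticCurves.Greenberg1999 WeierstrassCurve
  Summit.BirchSwinnertonDyer.Rank1Residual.X2.GreenbergVatsalReductionDatum
  Summit.BirchSwinnertonDyer.Rank1Residual.GaloisImage
  Summit.BirchSwinnertonDyer.Rank1Residual.GaloisImage.RamifiedOrdinaryLineTwist
  Summit.BirchSwinnertonDyer.Rank1Residual.AdditivePotMult

/-! ## §3 ASCENT to `ker κ` (p07's `GreenbergKerCoprimeAscent`, index `[Γ_ℚ : Gal(ℚ̄/K)] = 2`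
prime to the odd `p`) -/

section Ascent

variable (V : WeierstrassCurve ℚ) [V.IsGloballyMinimal] (p : ℕ) [Fact p.Prime]
  (κ : ZpExtension ℚ p) {v : HeightOneSpectrum (𝓞 ℚ)} {W : WeierstrassCurve ℚ}
  (t : V.geomPrimaryTorsion p ≃+ W.geomPrimaryTorsion p)
  (tsign : ∀ g : absoluteGaloisGroup ℚ, (∀ m, t (g • m) = g • t m) ∨ (∀ m, t (g • m) = -(g • t m)))
  (K : Type) [Field K] [NumberField K] (h2 : Module.finrank ℚ K = 2) {θ : K} {c : ℚ}
  (hθ : θ ∉ Set.range (algebraMap ℚ K)) (hc : θ ^ 2 = algebraMap ℚ K c)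

include h2 hθ hc in
/-- **'Kummer ⊆ Greenberg' over `ℚ_∞` for the transported datum, GENERIC transport** — level
`ker κ`: `W.localKerOver p (ker κ) ℚ_v ≤ (twistMap N_V t).greenbergKer (ker κ)`, for `t` with a sign
rule, equivariant on `galRange K` (`K/ℚ` quadratic, `K = ℚ(θ)`, `θ² = c`), Kummer square `hKum` at
level `ker κ ⊓ galRange K`. Level `ker κ ⊓ galRange K` by `localKerOver_le_greenbergKer_twistMap`,
then p07's prime-to-`p` ASCENT `localKerOver_le_greenbergKer_kerSubgroup_of_index_coprime`
(`[Γ_ℚ : galRange K] = 2`, `p` odd). UNCONDITIONAL; no ordinarity of `V` needed.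
[cite: GreenbergLNM1716, §2 pp. 69–75 and §5 p. 143] [cite: SilvermanAEC2009, X.5 Cor. 5.4] -/
theorem localKerOver_le_greenbergKer_twistMap_kerSubgroup (hp2 : p ≠ 2)
    (hΔ : ¬ (p : ℤ) ∣ V.minimalDiscriminantInt) (hpv : ((p : ℕ) : 𝓞 ℚ) ∈ v.asIdeal)
    (htU : ∀ g ∈ galRange (K := ℚ) K, ∀ m : V.geomPrimaryTorsion p, t (g • m) = g • t m)
    (hKum : ∀ s : V.subgroupH1 p (κ.kerSubgroup ⊓ galRange (K := ℚ) K),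
      s ∈ V.localKerOver p (κ.kerSubgroup ⊓ galRange (K := ℚ) K) (v.adicCompletion ℚ) ↔
        h1Equiv (G := ↥(κ.kerSubgroup ⊓ galRange (K := ℚ) K)) t
            (smul_of_mem_inf_galRange V p κ t K htU) s ∈
          W.localKerOver p (κ.kerSubgroup ⊓ galRange (K := ℚ) K) (v.adicCompletion ℚ)) :
    W.localKerOver p κ.kerSubgroup (v.adicCompletion ℚ) ≤
      (twistMap (reductionDatum V p hpv hΔ) t tsign).greenbergKer κ.kerSubgroup := by
  haveI : IsGalois ℚ K := isGalois_of_finrank_eq_two K h2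
  have hσ₀ := sigmaQ_ne_one K h2 hθ hc
  haveI : (galRange (K := ℚ) K).Normal := normal_galRange K h2 hσ₀
  have hUo : IsOpen (galRange (K := ℚ) K : Set (absoluteGaloisGroup ℚ)) := isOpen_galRange K
  have hcop : (galRange (K := ℚ) K).index.Coprime p := by
    rw [index_galRange K h2 hσ₀]
    exact (Nat.coprime_primes Nat.prime_two (Fact.out : p.Prime)).2 (Ne.symm hp2)
  -- level `ker κ ⊓ galRange K`
  have hH := localKerOver_le_greenbergKer_twistMap V p t tsign hΔ hpv
    (κ.kerSubgroup ⊓ galRange (K := ℚ) K) (smul_of_mem_inf_galRange V p κ t K htU) hKum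
  -- ascend to `ker κ`
  exact localKerOver_le_greenbergKer_kerSubgroup_of_index_coprime W p
    (twistMap (reductionDatum V p hpv hΔ) t tsign) κ hUo hcop hH

end Ascent

/-! ## §4 The geometric transport: the '≥' END THEOREM, the EQUALITY (mod `hGrK`), and the
`∀ κ ∀ v`-shaped binders of cc-typer-2's adapter `ramifiedLineKummerEqAt_of_plus_unique_of_datum` -/

section GeomEnd

variable (V : WeierstrassCurve ℚ) [V.IsGloballyMinimal] (K : Type) [Field K]
  [NumberField K] (h2 : Module.finrank ℚ K = 2) {θ : K} {c : ℚ} (hθ : θ ∉ Set.range (algebraMap ℚ K))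
  (hc : θ ^ 2 = algebraMap ℚ K c) (p : ℕ) [Fact p.Prime] {W : WeierstrassCurve ℚ}
  {C : VariableChange ℚ} (hC : C • V.quadraticTwist c = W)

include h2 hθ hc in
/-- **END THEOREM ('≥', F7) — 'Kummer ⊆ Greenberg' over `ℚ_∞` for `W = C • V^{(c)}` and the twisted
datum `twistMap (reductionDatum V p) (twistPrimaryEquiv⁻¹ ≫ primaryIso)`:**
`W.localKerOver p (ker κ) ℚ_v ≤ (twistMap …).greenbergKer (ker κ)`. Hypotheses ONLY `p ≠ 2`,
`p ∤ Δ_V`, `p ∈ v`, `[K:ℚ] = 2`, `θ ∉ ℚ`, `θ² = c`, `C • V^{(c)} = W` — no ordinarity, no `ord_v c`,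
no named fact: UNCONDITIONAL. (cc-typer-2's bridge lemma (B1).)
[cite: GreenbergLNM1716, §2 pp. 69–75 and §5 p. 143] [cite: SilvermanAEC2009, X.5 Cor. 5.4] -/
theorem localKerOver_le_greenbergKer_twistMap_geomTransport (κ : ZpExtension ℚ p) (hp2 : p ≠ 2)
    (hΔ : ¬ (p : ℤ) ∣ V.minimalDiscriminantInt) {v : HeightOneSpectrum (𝓞 ℚ)}
    (hpv : ((p : ℕ) : 𝓞 ℚ) ∈ v.asIdeal) :
    W.localKerOver p κ.kerSubgroup (v.adicCompletion ℚ) ≤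
      (twistMap (reductionDatum V p hpv hΔ)
        ((twistPrimaryEquiv V K hθ hc p).symm.trans (primaryIso p hC))
        (geomTransport_sign V K h2 hθ hc p hC)).greenbergKer κ.kerSubgroup :=
  localKerOver_le_greenbergKer_twistMap_kerSubgroup V p κ
    ((twistPrimaryEquiv V K hθ hc p).symm.trans (primaryIso p hC)) (geomTransport_sign V K h2 hθ hc p hC)
    K h2 hθ hc hp2 hΔ hpv (fun _ hg m ↦ geomTransport_smul_of_mem V K hθ hc p hC hg m)
    (fun s ↦ mem_localKerOver_iff_h1Equiv_geomTransport V K hθ hc p hC _ inf_le_right _ _ s)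

include h2 hθ hc in
/-- **THE R-D IDENTIFICATION for the twisted datum over `ℚ_∞` — EQUALITY, mod `hGrK`:**
`(twistMap (reductionDatum V p) t).greenbergKer (ker κ) = W.localKerOver p (ker κ) ℚ_v` for
`W = C • V^{(c)}`, `V` good ordinary at the odd `p`, `κ` cyclotomic, `p ∈ v`, `ord_v c = 1` — '≤'
is F6 `greenbergKer_twistMap_geomTransport_le_localKerOver` (CONDITIONAL on the typed Greenberg
Prop. 2.4 `hGrK`), '≥' is `localKerOver_le_greenbergKer_twistMap_geomTransport` (unconditional). This
is literally the body of cc-typer-2's `Additive.RamifiedLineKummerEqAt W p` for the ONE datum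
`L = twistMap (reductionDatum V p) t` (her ∀-`L` binder needs in addition the uniqueness of the
ramified ordinary line, (B2), not claimed here). [cite: GreenbergLNM1716, §2 Props. 2.2, 2.4 (pp. 73–75), §5 p. 143]
[cite: GreenbergVatsal2000, §2 p. 26] -/
theorem greenbergKer_twistMap_geomTransport_eq_localKerOver [V.IsElliptic] (κ : ZpExtension ℚ p)
    {v : HeightOneSpectrum (𝓞 ℚ)} (hGrK : imKummer_ge_strictCondition_goodOrdinary) (hp2 : p ≠ 2)
    (hΔ : ¬ (p : ℤ) ∣ V.minimalDiscriminantInt) (hord : ¬ (p : ℤ) ∣ V.frobeniusTrace p)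
    (hκ : κ.IsCyclotomic) (hpv : ((p : ℕ) : 𝓞 ℚ) ∈ v.asIdeal)
    (hval : v.valuation ℚ c = WithZero.exp (-1 : ℤ)) :
    (twistMap (reductionDatum V p hpv hΔ) ((twistPrimaryEquiv V K hθ hc p).symm.trans (primaryIso p hC))
        (geomTransport_sign V K h2 hθ hc p hC)).greenbergKer κ.kerSubgroup =
      W.localKerOver p κ.kerSubgroup (v.adicCompletion ℚ) :=
  le_antisymm (greenbergKer_twistMap_geomTransport_le_localKerOver V K h2 hθ hc p hC κ hGrK hp2 hΔ
      hord hκ hpv hval)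
    (localKerOver_le_greenbergKer_twistMap_geomTransport V K h2 hθ hc p hC κ hp2 hΔ hpv)

include h2 hθ hc in
/-- Both inclusions at once, strict currency included: over `ℚ_∞`, for the twisted datum `N_W`,
`N_W.strictKer (ker κ) = N_W.greenbergKer (ker κ) = W.localKerOver p (ker κ) ℚ_v` (mod `hGrK`); the
first equality is F5/F3 (`greenbergKer_eq_strictKer_of_smul_eq_neg` — an element of `I_v ∩ ker κ`
acts as `−1` on `Ṽ[p^∞] ⊗ χ_c`). [cite: GreenbergLNM1716, §2 Props. 2.2, 2.4 (pp. 73–75)]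
[cite: GreenbergVatsal2000, §2 p. 26] -/
theorem strictKer_twistMap_geomTransport_eq_localKerOver [V.IsElliptic] (κ : ZpExtension ℚ p)
    {v : HeightOneSpectrum (𝓞 ℚ)} (hGrK : imKummer_ge_strictCondition_goodOrdinary) (hp2 : p ≠ 2)
    (hΔ : ¬ (p : ℤ) ∣ V.minimalDiscriminantInt) (hord : ¬ (p : ℤ) ∣ V.frobeniusTrace p)
    (hκ : κ.IsCyclotomic) (hpv : ((p : ℕ) : 𝓞 ℚ) ∈ v.asIdeal)
    (hval : v.valuation ℚ c = WithZero.exp (-1 : ℤ)) :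
    (twistMap (reductionDatum V p hpv hΔ) ((twistPrimaryEquiv V K hθ hc p).symm.trans (primaryIso p hC))
        (geomTransport_sign V K h2 hθ hc p hC)).strictKer κ.kerSubgroup =
      W.localKerOver p κ.kerSubgroup (v.adicCompletion ℚ) := by
  rw [← greenbergKer_twistMap_kerSubgroup_eq_strictKer V p κ
    ((twistPrimaryEquiv V K hθ hc p).symm.trans (primaryIso p hC)) (geomTransport_sign V K h2 hθ hc p hC)
    K h2 hθ hc hp2 hΔ hκ hpv (fun _ hg m ↦ geomTransport_smul_of_mem V K hθ hc p hC hg m)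
    (exists_mem_absInertia_geomTransport_smul_eq_neg V K h2 hθ hc p hC hp2 hpv hval)]
  exact greenbergKer_twistMap_geomTransport_eq_localKerOver V K h2 hθ hc p hC κ hGrK hp2 hΔ hord hκ
    hpv hval

end GeomEnd

end Summit.BirchSwinnertonDyer.Rank1Residual.Additive.TameDescent

end
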